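import Summits.BirchSwinnertonDyer.BirchSwinnertonDyer.Theorems.PrintCf2SplitBadTwoLocSurjLayerTrivial
import HarnessLib

/-!
# Crux `PrintCf2.SplitBadTwoRankOneOfFacts` (stmt-BirchSwinnertonDyer-20368), S3n′-FACT-FREE road, road (a):
# (SUR) at a finite layer, θ = 1 — MODEL-FREE levels (any trivial cyclic `Γ_F`-modules `N₀ ≃ ℤ/p^k`, `N ≃ ℤ/p^M`)

Cell `bsd-print-cf2`, WIDTH seat `bsd-line-cf2-p1-w7` g6 (prover-bsd-line-cf2-p1-w7-g6-0); `--supports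
stmt-BirchSwinnertonDyer-20368` (helper, Theses-free). HONEST FRAMING: nothing here closes the crux or a registered stub;
BSD is not proved by any of this; no summit statement is proved by this seat. No definition, no named fact, no `sorry`.
UNCONDITIONAL (p702810 transported along equivariant additive isomorphisms).

WHAT. `KummerProNull.exists_selmer_sub_localMap_mem_of_trivial` (p702810) is stated on the MODELS `ℤ/p^k`, `ℤ/p^M` (`ZMod`). The
U-currency consumer of road (a) — `-w4` g12's `hLSk` of `UpperBaseLift.locSurj_layerSubgroup_of_forall_torsionExponent`, reached through
`-w6` g6's H¹-transport `subgroupH1 U N ≃+ H¹(Γ_L, N|res)` — meets the levels as the torsion pieces `A[p^k] ↪ A[p^M]` of the divisible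
module `A` (types with their own trivial `Γ_K`-action), not as `ZMod`. THIS FILE removes the model:
* **`exists_selmer_sub_localMap_mem_of_trivial_of_addEquiv`** — the same conclusion for ANY discrete `Γ_F`-modules `ρ₀` on `N₀`, `ρ` on `N`
  with TRIVIAL action, ANY additive isomorphisms `e₀ : N₀ ≃+ ZMod (p^k)`, `e : N ≃+ ZMod (p^M)` and ANY intertwining `ι : N₀ → N` with
  `e (ι (e₀⁻¹ 1)) = p^{M−k}`: for `𝓕 = ⊤` above `v` / `H¹_ur` elsewhere, `S ⊇ {w ∣ p} ∪ {w ∣ ∞}`, `𝓖 ≥ 𝓕` unramified outside `S`, and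
  targets `s_w ∈ H¹(F_w, N₀)` with `H¹(ι_w) s_w ∈ 𝓖_w` (`w ∈ S`): `∃ x ∈ H¹_𝓖(F, N), ∀ w ∈ S, loc_w x − H¹(ι_w) s_w ∈ 𝓕_w`.
Mechanism: the isomorphisms are intertwining maps `E₀, E` to the trivial `ZMod` modules (trivial actions on both sides); Selmer structures,
Selmer groups, local conditions (`⊤`, `H¹_ur`) and the conclusion are transported by the tree's `SelmerStructure.induced` /
`map_mem_selmerGroup_induced_iff` / `localMap_mem_induced_iff` / `localization_map_one_eq` / `map_mem_unramifiedSubgroup` (X11b, GaloisImage).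
beyond-print theorem: no. presearch: NOTES.md (pure transport).

References: J. S. Milne, *Arithmetic Duality Theorems* (2006), I Thm. 4.10; B. Howard, Compos. Math. 140 (2004), Thm. 2.1.11.
-/

noncomputable section

set_option linter.dupNamespace false
set_option autoImplicit false

open scoped Classical ContRepresentation
open NumberField IsDedekindDomain Field
open Literature.NumberTheory.GaloisRepresentations
open Literature.NumberTheory.GaloisRepresentations.DiscreteGaloisModule
open Literature.NumberTheory.GaloisCohomology
open Literature.NumberTheory.EllipticCurves (IsImaginaryQuadratic)
open Summit.BirchSwinnertonDyer.Rank1Residual.GaloisImage.Transport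
open Summit.BirchSwinnertonDyer.Rank1Residual.GaloisImage.CoreRankZero (localization_map_one_eq)
open Summit.BirchSwinnertonDyer.Rank1Residual.X11b.Levels

namespace Summit.BirchSwinnertonDyer.BirchSwinnertonDyer.Theorems.PrintCf2.KummerProNull

variable {K : Type} [Field K] [NumberField K] {p : ℕ} [hp : Fact p.Prime]

/-- **(SUR_n), θ = 1, Γ_F-currency, model-free levels.** As `exists_selmer_sub_localMap_mem_of_trivial` (p702810), for arbitrary
trivial discrete `Γ_F`-modules `ρ₀` on `N₀ ≃+ ℤ/p^k` and `ρ` on `N ≃+ ℤ/p^M` (additive isomorphisms `e₀`, `e`; any intertwining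
`ι : N₀ → N` with `e (ι (e₀⁻¹ 1)) = p^{M−k}`). [cite: MilneADT2006, Ch. I, Thm. 4.10 (b)] [cite: Howard2004HeegnerKolyvagin, Thm. 2.1.11 (arXiv:1202.6340 p. 6)] -/
theorem exists_selmer_sub_localMap_mem_of_trivial_of_addEquiv (hK : IsImaginaryQuadratic K)
    {v vbar : HeightOneSpectrum (𝓞 K)} (hv : ((p : ℕ) : 𝓞 K) ∈ v.asIdeal) (hvbar : ((p : ℕ) : 𝓞 K) ∈ vbar.asIdeal)
    (hne : vbar ≠ v) (F : IntermediateField K (AlgebraicClosure K)) [FiniteDimensional K F] [IsAbelianGalois K F]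
    [NumberField F] (k : ℕ) :
    ∃ M : ℕ, k ≤ M ∧ ∀ {N₀ N : Type} [AddCommGroup N₀] [TopologicalSpace N₀] [DiscreteTopology N₀]
      [AddCommGroup N] [TopologicalSpace N] [DiscreteTopology N]
      (ρ₀ : DiscreteGaloisModule F N₀) (ρ : DiscreteGaloisModule F N)
      (_hρ₀ : ∀ (σ : absoluteGaloisGroup F) (m : N₀), ρ₀ σ m = m)
      (_hρ : ∀ (σ : absoluteGaloisGroup F) (m : N), ρ σ m = m)
      (e₀ : N₀ ≃+ ZMod (p ^ k)) (e : N ≃+ ZMod (p ^ M))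
      (ι : ρ₀.toContRepresentation →ⁱL ρ.toContRepresentation)
      (_hι : e (ι (e₀.symm 1)) = ((p ^ (M - k) : ℕ) : ZMod (p ^ M)))
      (𝓕 : SelmerStructure ρ)
      (_h𝓕v : ∀ w : HeightOneSpectrum (𝓞 F), w.under (𝓞 K) = v → 𝓕 (Sum.inr w) = ⊤)
      (_h𝓕 : ∀ w : HeightOneSpectrum (𝓞 F), w.under (𝓞 K) ≠ v →
        𝓕 (Sum.inr w) = unramifiedSubgroup (GaloisRep.toLocal w ρ) 1)
      (S : Finset (Place F))
      (_hSp : ∀ w : HeightOneSpectrum (𝓞 F), ((p : ℕ) : 𝓞 F) ∈ w.asIdeal → (Sum.inr w : Place F) ∈ S)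
      (_hS : ∀ w : InfinitePlace F, (Sum.inl w : Place F) ∈ S)
      (𝓖 : SelmerStructure ρ) (_hle : 𝓕 ≤ 𝓖) (_h𝓖 : 𝓖.IsUnramifiedOutside S)
      (s : Π w : Place F, galoisCohomology (ρ₀.toLocal w) 1) (_hs : ∀ w ∈ S, localMap ι w (s w) ∈ 𝓖 w),
      ∃ x ∈ 𝓖.selmerGroup, ∀ w ∈ S, galoisCohomology.localization ρ w 1 x - localMap ι w (s w) ∈ 𝓕 w := by
  obtain ⟨M, hkM, hM⟩ := exists_selmer_sub_localMap_mem_of_trivial (p := p) hK hv hvbar hne F k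
  refine ⟨M, hkM, ?_⟩
  intro N₀ N _ _ _ _ _ _ ρ₀ ρ hρ₀ hρ e₀ e ι hι 𝓕 h𝓕v h𝓕 S hSp hSinf 𝓖 hle h𝓖 s hs
  -- the ZMod models (trivial action) and the intertwining isomorphisms to them
  let Z₀ : DiscreteGaloisModule F (ZMod (p ^ k)) := ContinuousRep.trivial (absoluteGaloisGroup F) ℤ (ZMod (p ^ k))
  let Z : DiscreteGaloisModule F (ZMod (p ^ M)) := ContinuousRep.trivial (absoluteGaloisGroup F) ℤ (ZMod (p ^ M))
  let E : ρ.toContRepresentation →ⁱL Z.toContRepresentation :=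
    { toContinuousLinearMap := ⟨e.toAddMonoidHom.toIntLinearMap, continuous_of_discreteTopology⟩
      isIntertwining' := fun σ ↦ ContinuousLinearMap.ext fun x ↦ by
        change e (ρ σ x) = Z σ (e x)
        rw [hρ]; rfl }
  let E' : Z.toContRepresentation →ⁱL ρ.toContRepresentation :=
    { toContinuousLinearMap := ⟨e.symm.toAddMonoidHom.toIntLinearMap, continuous_of_discreteTopology⟩
      isIntertwining' := fun σ ↦ ContinuousLinearMap.ext fun x ↦ by
        change e.symm (Z σ x) = ρ σ (e.symm x)
        rw [hρ]; rfl }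
  let E₀ : ρ₀.toContRepresentation →ⁱL Z₀.toContRepresentation :=
    { toContinuousLinearMap := ⟨e₀.toAddMonoidHom.toIntLinearMap, continuous_of_discreteTopology⟩
      isIntertwining' := fun σ ↦ ContinuousLinearMap.ext fun x ↦ by
        change e₀ (ρ₀ σ x) = Z₀ σ (e₀ x)
        rw [hρ₀]; rfl }
  let E₀' : Z₀.toContRepresentation →ⁱL ρ₀.toContRepresentation :=
    { toContinuousLinearMap := ⟨e₀.symm.toAddMonoidHom.toIntLinearMap, continuous_of_discreteTopology⟩
      isIntertwining' := fun σ ↦ ContinuousLinearMap.ext fun x ↦ by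
        change e₀.symm (Z₀ σ x) = ρ₀ σ (e₀.symm x)
        rw [hρ₀]; rfl }
  have hEE' : ∀ a, E' (E a) = a := fun a ↦ e.symm_apply_apply a
  have hE'E : ∀ b, E (E' b) = b := fun b ↦ e.apply_symm_apply b
  have hE₀E₀' : ∀ a, E₀' (E₀ a) = a := fun a ↦ e₀.symm_apply_apply a
  have hE₀'E₀ : ∀ b, E₀ (E₀' b) = b := fun b ↦ e₀.apply_symm_apply b
  -- the transported transition `ι_Z = E ∘ ι ∘ E₀⁻¹`
  let ιZ : Z₀.toContRepresentation →ⁱL Z.toContRepresentation := E.comp (ι.comp E₀')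
  have hιZ : ιZ 1 = ((p ^ (M - k) : ℕ) : ZMod (p ^ M)) := hι
  -- local images: `H¹_ur ↦ H¹_ur`, `⊤ ↦ ⊤` under the local isomorphisms
  have hunr : ∀ w : HeightOneSpectrum (𝓞 F),
      (unramifiedSubgroup (GaloisRep.toLocal w ρ) 1).map (localMap E (Sum.inr w)) =
        unramifiedSubgroup (GaloisRep.toLocal w Z) 1 := by
    intro w
    ext y
    constructor
    · rintro ⟨z, hz, rfl⟩
      exact map_mem_unramifiedSubgroup (ρ₁ := GaloisRep.toLocal w ρ) (ρ₂ := GaloisRep.toLocal w Z)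
        (E.restrictField (w.adicCompletion F)) hz
    · intro hy
      refine ⟨localMap E' (Sum.inr w) y, ?_, localMap_localMap_eq_self E' E hE'E _ y⟩
      exact map_mem_unramifiedSubgroup (ρ₁ := GaloisRep.toLocal w Z) (ρ₂ := GaloisRep.toLocal w ρ)
        (E'.restrictField (w.adicCompletion F)) hy
  have htop : ∀ w : Place F, (⊤ : AddSubgroup _).map (localMap E w) = ⊤ := fun w ↦ by
    rw [eq_top_iff]
    intro y _
    exact ⟨localMap E' w y, AddSubgroup.mem_top _, localMap_localMap_eq_self E' E hE'E w y⟩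
  -- the transported Selmer structures and targets
  have h𝓕vZ : ∀ w : HeightOneSpectrum (𝓞 F), w.under (𝓞 K) = v → 𝓕.induced E (Sum.inr w) = ⊤ := fun w hw ↦ by
    change (𝓕 (Sum.inr w)).map (localMap E (Sum.inr w)) = ⊤
    rw [h𝓕v w hw, htop]
  have h𝓕Z : ∀ w : HeightOneSpectrum (𝓞 F), w.under (𝓞 K) ≠ v →
      𝓕.induced E (Sum.inr w) = unramifiedSubgroup (GaloisRep.toLocal w Z) 1 := fun w hw ↦ by
    change (𝓕 (Sum.inr w)).map (localMap E (Sum.inr w)) = _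
    rw [h𝓕 w hw, hunr]
  have hleZ : 𝓕.induced E ≤ 𝓖.induced E := fun w ↦ AddSubgroup.map_mono (hle w)
  have h𝓖Z : (𝓖.induced E).IsUnramifiedOutside S := by
    refine ⟨h𝓖.1, fun w hw ↦ ?_⟩
    change (𝓖 (Sum.inr w)).map (localMap E (Sum.inr w)) = _
    rw [h𝓖.2 w hw, hunr]
  have hsZ : ∀ w ∈ S, localMap ιZ w (localMap E₀ w (s w)) ∈ 𝓖.induced E w := fun w hw ↦ by
    refine ⟨localMap ι w (s w), hs w hw, ?_⟩
    change localMap E w (localMap ι w (s w)) = localMap (E.comp (ι.comp E₀')) w (localMap E₀ w (s w))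
    rw [localMap_comp_apply, localMap_comp_apply, localMap_localMap_eq_self E₀ E₀' hE₀E₀']
  -- apply the model statement and pull back
  obtain ⟨xZ, hxZ, hxZS⟩ := hM Z₀ Z (fun _ _ ↦ rfl) (fun _ _ ↦ rfl) ιZ hιZ (𝓕.induced E) h𝓕vZ h𝓕Z S hSp hSinf
    (𝓖.induced E) hleZ h𝓖Z (fun w ↦ localMap E₀ w (s w)) hsZ
  refine ⟨galoisCohomology.map E' 1 xZ, ?_, fun w hw ↦ ?_⟩
  · rw [← map_mem_selmerGroup_induced_iff E E' 𝓖 hEE', map_map_eq_self_of_comp_eq E' E hE'E]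
    exact hxZ
  · rw [← localMap_mem_induced_iff E E' 𝓕 hEE' w, map_sub]
    have h1 : localMap E w (galoisCohomology.localization ρ w 1 (galoisCohomology.map E' 1 xZ)) =
        galoisCohomology.localization Z w 1 xZ := by
      have h := localization_map_one_eq E w (galoisCohomology.map E' 1 xZ)
      rw [map_map_eq_self_of_comp_eq E' E hE'E] at h
      exact h.symm
    have h2 : localMap E w (localMap ι w (s w)) = localMap ιZ w (localMap E₀ w (s w)) := by
      change localMap E w (localMap ι w (s w)) = localMap (E.comp (ι.comp E₀')) w (localMap E₀ w (s w))
      rw [localMap_comp_apply, localMap_comp_apply, localMap_localMap_eq_self E₀ E₀' hE₀E₀']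
    rw [h1, h2]
    exact hxZS w hw

end Summit.BirchSwinnertonDyer.BirchSwinnertonDyer.Theorems.PrintCf2.KummerProNull

end
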